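import Summits.AtomisticToContinuum.FouriersLaw.Theses.PhononMeanFreePath

/-!
# CoherentDephasing — kill switches (negative-side support)

Formal versions of the route's kill criteria for crux `PhononMeanFreePath.CoherentDephasing`
(item stmt-AtomisticToContinuum-11810), from the standing disprover's work file
`Cruxes/CoherentDephasing/Disproof.lean` §7, all sorry-free. Writing
`r_N(t) = ∫ p₀ · (K_t p_N) dμ_T` for the `(N+1)`-site chain `pinnedChain ω₂ lam β γ` at temperature
`T`, each of the following, exhibited at ONE admissible parameter point (`ω₂, lam, β, γ, T > 0`),
refutes the crux:

* the un-normalised coherent channel does not close: `∫₀^∞ r_N² ↛ 0`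
  (`not_crux_of_not_tendsto_integral`; uses `N·b_N → 0 ⇒ b_N → 0`);
* a `c/N` floor: `N ∫₀^∞ r_N² ≥ c > 0` for infinitely many `N` (`not_crux_of_frequently_ge`) — the
  shape an odd hidden conserved quantity, a transparent band or persistent finite-`N` transmission
  resonances would produce;
* non-integrability of `t ↦ r_N(t)²` on `(0,∞)` at one `N` (`not_crux_of_not_integrableOn`) —
  excluded in substance by exponential ergodicity of the finite open chain (CEHR 2018, C1–C5 hold
  for `lam, β > 0`), recorded because the clause is part of the typed statement.

No such witness is known or expected (see the work file's verdict); these lemmas only fix what a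
refutation must deliver.
-/

noncomputable section

open MeasureTheory Filter Topology Set
open Literature.MathematicalPhysics.KineticTheory.HeatConduction
open Summit.AtomisticToContinuum.FouriersLaw.Theses.PhononMeanFreePath

namespace Summit.AtomisticToContinuum.FouriersLaw.Theorems.CoherentDephasing.Negative.KillSwitches

/-- If `N · b_N → 0` then `b_N → 0` (real sequences). [folklore] -/
theorem tendsto_zero_of_tendsto_natMul_zero {b : ℕ → ℝ}
    (h : Tendsto (fun N : ℕ => (N : ℝ) * b N) atTop (𝓝 0)) : Tendsto b atTop (𝓝 0) := by
  have hinv : Tendsto (fun N : ℕ => (N : ℝ)⁻¹) atTop (𝓝 0) :=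
    tendsto_inv_atTop_zero.comp tendsto_natCast_atTop_atTop
  have hprod := h.mul hinv
  rw [zero_mul] at hprod
  refine hprod.congr' ?_
  filter_upwards [eventually_gt_atTop 0] with N hN
  have hN' : (N : ℝ) ≠ 0 := Nat.cast_ne_zero.2 (Nat.pos_iff_ne_zero.1 hN)
  field_simp

/-- **Kill switch 1.** If at an admissible parameter point the coherent channel `∫₀^∞ r_N²` does not
tend to `0`, the crux is false. [folklore] -/
theorem not_crux_of_not_tendsto_integral {ω₂ lam β γ T : ℝ} (hω : 0 < ω₂) (hl : 0 < lam)
    (hβ : 0 < β) (hγ : 0 < γ) (hT : 0 < T)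
    (h : ¬ Tendsto (fun N : ℕ => ∫ t in Ioi (0 : ℝ), (∫ z, z.2 0 * (∫ y, y.2 (Fin.last N)
          ∂((pinnedChain ω₂ lam β γ).transitionKernel (N + 1) T T t.toNNReal z))
          ∂((pinnedChain ω₂ lam β γ).gibbsMeasure (N + 1) T)) ^ 2) atTop (𝓝 0)) :
    ¬ CoherentDephasing := fun hC =>
  h (tendsto_zero_of_tendsto_natMul_zero (hC ω₂ lam β γ hω hl hβ hγ T hT).2)

/-- **Kill switch 2.** If at an admissible parameter point `c ≤ N ∫₀^∞ r_N²` for some `c > 0` and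
infinitely many `N`, the crux is false. [folklore] -/
theorem not_crux_of_frequently_ge {ω₂ lam β γ T c : ℝ} (hω : 0 < ω₂) (hl : 0 < lam)
    (hβ : 0 < β) (hγ : 0 < γ) (hT : 0 < T) (hc : 0 < c)
    (h : ∃ᶠ N : ℕ in atTop, c ≤ (N : ℝ) * ∫ t in Ioi (0 : ℝ), (∫ z, z.2 0 * (∫ y, y.2 (Fin.last N)
          ∂((pinnedChain ω₂ lam β γ).transitionKernel (N + 1) T T t.toNNReal z))
          ∂((pinnedChain ω₂ lam β γ).gibbsMeasure (N + 1) T)) ^ 2) :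
    ¬ CoherentDephasing := by
  intro hC
  have hev := (hC ω₂ lam β γ hω hl hβ hγ T hT).2.eventually (gt_mem_nhds hc)
  obtain ⟨N, hge, hlt⟩ := (h.and_eventually hev).exists
  exact absurd hlt (not_lt.2 hge)

/-- **Kill switch 3.** If at an admissible parameter point `t ↦ r_N(t)²` is not integrable on
`(0,∞)` for some `N`, the crux is false. [folklore] -/
theorem not_crux_of_not_integrableOn {ω₂ lam β γ T : ℝ} (hω : 0 < ω₂) (hl : 0 < lam)
    (hβ : 0 < β) (hγ : 0 < γ) (hT : 0 < T) {N : ℕ}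
    (h : ¬ IntegrableOn (fun t : ℝ => (∫ z, z.2 0 * (∫ y, y.2 (Fin.last N)
          ∂((pinnedChain ω₂ lam β γ).transitionKernel (N + 1) T T t.toNNReal z))
          ∂((pinnedChain ω₂ lam β γ).gibbsMeasure (N + 1) T)) ^ 2) (Ioi 0)) :
    ¬ CoherentDephasing := fun hC =>
  h ((hC ω₂ lam β γ hω hl hβ hγ T hT).1 N)

end Summit.AtomisticToContinuum.FouriersLaw.Theorems.CoherentDephasing.Negative.KillSwitches
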